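import Mathlib
import HarnessLib
import Literature.MathematicalPhysics.StatisticalMechanics.LinearisedMapABKM
import Literature.MathematicalPhysics.StatisticalMechanics.RenormalisationStepLocality
import Literature.MathematicalPhysics.QuantumFieldTheory.TphiSeminormFluctuationContraction

/-!
# The fluctuation integral of a norm-bounded local functional is `C^{r₀}`:
# `R_{k+1}K = ∫ K(· + ξ) μ_{k+1}(dξ)` ([ABKM19] Lemma 8.4 / [BBS19] Prop. 7.3.1, smoothness part)

The Lemma 10.x files of the tree carry the hypothesis `ContDiff ℝ r₀ (fluct 𝒞 (K X))` next to the
norm bound of `K`.  It is a CONSEQUENCE of the norm bound: differentiation under the integral sign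
to all orders `≤ r₀` (the tree's `QuantumFieldTheory.DerivDominated`, whose hypotheses follow from
`‖K‖_{T,w} ≤ C` and section domination of the weight, `TayNormLE.derivDominated_section`).  Here:

* **`contDiff_integral_comp_add_of_tayNormLE`** (via the tree's `DerivDominated.contDiff_integral`) — for a `T`-local `C^{r₀}` functional `K` with
  `‖K‖_{T,w} ≤ C` and `w` section-dominated for `μ`: `ψ ↦ ∫ K(ψ + ξ) μ(dξ)` is `C^{r₀}`;
* **`contDiff_fluct_abkm`** — for the torus weight tower with the conclusions of Theorem 7.1
  (`AbkmWeightBounds`) and `‖K‖_{T, w_k^X} ≤ C` (any gauge `T`): `fluct 𝒞_{k+1} K` is `C^{r₀}` —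
  discharging the hypothesis `hRd` of `weakNormLE_opC_abkm`, `hamNorm_opB_le`, ….

Everything is proved; no named fact.

## References
* S. Adams, S. Buchholz, R. Kotecký, S. Müller, arXiv:1910.13564, Lemma 8.4 [AdamsBuchholzKoteckyMuller2019].
* R. Bauerschmidt, D. Brydges, G. Slade, LNM 2242 (2019), Prop. 7.3.1 [BauerschmidtBrydgesSlade2019RG].
-/

noncomputable section

open MeasureTheory Filter Topology Set Metric

/-! ## The fluctuation integral of a norm-bounded local functional -/

namespace Literature.MathematicalPhysics.StatisticalMechanics.GradientRG

open scoped BigOperators Classical MatrixOrder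
open Finset Matrix MeasureTheory ProbabilityTheory WithLp
open Literature.MathematicalPhysics.QuantumFieldTheory
open Literature.MathematicalPhysics.StatisticalMechanics.GradientFRD (cExt fourierCoeff mulMat)
open Literature.MathematicalPhysics.StatisticalMechanics.TorusPolymer (IsPolymer numBlocks)

section Generic

variable {E V : Type*} [NormedAddCommGroup E] [NormedSpace ℝ E] [FiniteDimensional ℝ E]
  [MeasurableSpace E] [OpensMeasurableSpace E] [NormedAddCommGroup V] [NormedSpace ℝ V]
  {𝔸 : Type*} [NormedRing 𝔸] [NormedAlgebra ℝ 𝔸] [CompleteSpace 𝔸]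

/-- **`ψ ↦ ∫ K(ψ + ξ) μ(dξ)` is `C^{r₀}`** for a `T`-local `C^{r₀}` functional `K` with `‖K‖_{T,w} ≤ C`
(`C ≥ 0`) and a weight `w` dominated along the section for `μ` ([ABKM19] Lemma 8.4: "the map
`R_{k+1}` … is well defined and smooth"). [cite: AdamsBuchholzKoteckyMuller2019, Lemma 8.4] -/
theorem contDiff_integral_comp_add_of_tayNormLE {T : E →ₗ[ℝ] V} {r₀ : ℕ} {w : E → ℝ} {K : E → 𝔸}
    {C : ℝ} {μ : Measure E} (h : TayNormLE T r₀ w K C) (hC : 0 ≤ C) (hK : ContDiff ℝ r₀ K)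
    (hloc : IsGaugeLocal T K) (hdom : WeightSectionDominated T w μ) :
    ContDiff ℝ r₀ (fun ψ => ∫ ξ, K (ψ + ξ) ∂μ) := by
  -- the lifted convolution on `range T` is `C^{r₀}`
  have hD := h.derivDominated_section hC hK hdom
  have hG : ContDiff ℝ r₀ (fun v : LinearMap.range T => ∫ ξ, gaugeLift T K (v + T.rangeRestrict ξ) ∂μ) :=
    hD.contDiff_integral
  -- and the convolution is its composition with `T`
  have hlocI : IsGaugeLocal T (fun ψ => ∫ ξ, K (ψ + ξ) ∂μ) :=
    isGaugeLocal_integral T μ fun ξ => hloc.comp_add_right _ ξ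
  have heq : (fun ψ => ∫ ξ, K (ψ + ξ) ∂μ) =
      (fun v : LinearMap.range T => ∫ ξ, gaugeLift T K (v + T.rangeRestrict ξ) ∂μ) ∘
        (gaugeRestrictCLM T) := by
    funext ψ
    simp only [Function.comp_apply]
    rw [← gaugeLift_integral_comp_add hloc μ, gaugeRestrictCLM_apply, gaugeLift_rangeRestrict hlocI]
  rw [heq]
  exact hG.comp (gaugeRestrictCLM T).contDiff

end Generic

/-! ## The torus: `R_{k+1}K` is `C^{r₀}` for `‖K‖_{T,w_k^X} ≤ C` -/

variable {d M : ℕ} [NeZero M]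

/-- **`R_{k+1}K = fluct 𝒞_{k+1} K` is `C^{r₀}`** for the torus weight tower with the conclusions of
Theorem 7.1 (`AbkmWeightBounds`; `θ̄ > 0`, `λ > 0`), a scale `k` with `k + 1 ≤ N + 1`, any gauge `T`,
and a `T`-local `C^{r₀}` functional `K` with `‖K‖_{T, w_k^X} ≤ C`.
[cite: AdamsBuchholzKoteckyMuller2019, Lemma 8.4] -/
theorem contDiff_fluct_abkm {L N Mord R n : ℕ} {θbar lam μ δ₁ δ₀ A𝒫 : ℝ}
    {𝒞 : ℕ → (Fin d → ZMod M) → ℝ} (hθbar : 0 < θbar) (hlam : 0 < lam)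
    (hB : AbkmWeightBounds L N Mord R n θbar lam μ δ₁ δ₀ A𝒫 𝒞
      (abkmWeightData L N Mord R θbar (schedDelta δ₀ δ₁ N) 𝒞))
    {k : ℕ} (hk : k + 1 ≤ N + 1) (X : Finset (Fin d → ZMod M))
    {V : Type*} [NormedAddCommGroup V] [NormedSpace ℝ V] (T : ((Fin d → ZMod M) → ℝ) →ₗ[ℝ] V)
    {r₀ : ℕ} {K : ((Fin d → ZMod M) → ℝ) → ℂ} {C : ℝ} (hC : 0 ≤ C) (hKd : ContDiff ℝ r₀ K)
    (hKloc : IsGaugeLocal T K)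
    (hK : TayNormLE T r₀ ((abkmWeightData L N Mord R θbar (schedDelta δ₀ δ₁ N) 𝒞).weight k X) K C) :
    ContDiff ℝ r₀ (fluct (𝒞 (k + 1)) K) := by
  set W := abkmWeightData L N Mord R θbar (schedDelta δ₀ δ₁ N) 𝒞 with hW
  have heven_all : ∀ j ∈ Finset.Icc 1 (N + 1), ∀ x, 𝒞 j (-x) = 𝒞 j x :=
    fun j hj => (hB.zero_sum_even j hj).2
  have heven : ∀ x, 𝒞 (k + 1) (-x) = 𝒞 (k + 1) x := heven_all (k + 1) (Finset.mem_Icc.2 ⟨by omega, hk⟩)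
  have hf_even := fun κ j => GradientFRD.cExt_fourierCoeff_neg (N := N) heven_all κ j
  have hnn := hB.multipliers_nonneg
  have hD := hB.dominated
  have hθlo : θbar ≤ thetaSeq θbar μ δ₁ N k := (hB.theta_mem k).1
  have hCeq := circulant_eq_mulMat_cExt hk heven (N := N)
  have hsub : ((1 : Matrix _ _ ℝ) - CFC.sqrt (Matrix.circulant (𝒞 (k + 1))) *
      ((1 + θbar / 2) • W.form k X) * CFC.sqrt (Matrix.circulant (𝒞 (k + 1)))).PosDef := by
    rw [hCeq]
    exact posDef_one_sub_smul_form W (c := fun j κ => cExt N (fun j => fourierCoeff (𝒞 j) κ) j)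
      hD hθbar hθlo hlam.le (by linarith) (by linarith)
      (fun k κ => derivMul_neg _ k _ κ) (fun κ => derivMul_nonneg (Nat.cast_nonneg L) k _ κ)
      (fun κ => hf_even κ (k + 1)) (fun κ => hnn (k + 1) κ)
      (fun k κ => tailMul_neg_of_cExt hf_even k κ) (fun κ => tailMul_succ N _ k κ)
      (fun κ => tailMul_nonneg (fun κ j => hnn j κ) (k + 1) κ) X
  have hwe : W.weight k X = expWeight (W.form k X) :=
    funext fun φ => WeightData.weight_eq_expWeight k X φ
  have hdom : WeightSectionDominated T (W.weight k X) (stepMeasure (𝒞 (k + 1))) := by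
    rw [hwe]
    exact weightSectionDominated_expWeight T (C := Matrix.circulant (𝒞 (k + 1)))
      (WeightData.form_posSemidef hD k X) (η := θbar / 2) (by linarith) hsub
  exact contDiff_integral_comp_add_of_tayNormLE hK hC hKd hKloc hdom

/-- **`R_{k+1}K(X)` is `C^{r₀}` for every connected `k`-polymer `X` when `‖K‖_k^{(A)} ≤ C`** (concrete
parameters `abkmNormParams`; `A > 0`). [cite: AdamsBuchholzKoteckyMuller2019, Lemma 8.4] -/
theorem contDiff_fluct_of_weakNormLE {L N Mord R n p r₀ : ℕ} {θbar lam μ δ₁ δ₀ A𝒫 h A : ℝ}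
    {𝒞 : ℕ → (Fin d → ZMod M) → ℝ} (hθbar : 0 < θbar) (hlam : 0 < lam)
    (hB : AbkmWeightBounds L N Mord R n θbar lam μ δ₁ δ₀ A𝒫 𝒞
      (abkmWeightData L N Mord R θbar (schedDelta δ₀ δ₁ N) 𝒞))
    {k : ℕ} (hk : k + 1 ≤ N + 1) (hA : 0 < A)
    {K : Finset (Fin d → ZMod M) → ((Fin d → ZMod M) → ℝ) → ℂ} {C : ℝ} (hC : 0 ≤ C)
    (hK : WeakNormLE (abkmNormParams L N Mord R p r₀ h θbar A (schedDelta δ₀ δ₁ N) 𝒞) k K C)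
    (hKd : ∀ X, ContDiff ℝ r₀ (K X))
    (hKloc : ∀ X, IsPolymer (L ^ k) X → Literature.Barriers.CriticalPhenomena.LongRangePhi4.Polymer.IsConn X →
      IsGaugeLocal ((abkmNormParams L N Mord R p r₀ h θbar A (schedDelta δ₀ δ₁ N) 𝒞).gauge k X) (K X))
    {X : Finset (Fin d → ZMod M)} (hX : IsPolymer (L ^ k) X)
    (hc : Literature.Barriers.CriticalPhenomena.LongRangePhi4.Polymer.IsConn X) :
    ContDiff ℝ r₀ (fluct (𝒞 (k + 1)) (K X)) := by
  set P := abkmNormParams L N Mord R p r₀ h θbar A (schedDelta δ₀ δ₁ N) 𝒞 with hP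
  have h1 : TayNormLE (P.gauge k X) r₀
      ((abkmWeightData L N Mord R θbar (schedDelta δ₀ δ₁ N) 𝒞).weight k X) (K X)
      (C * P.aFactor k X) := hK X hX hc
  exact contDiff_fluct_abkm hθbar hlam hB hk X (P.gauge k X)
    (mul_nonneg hC (WeakNormLE.aFactor_pos hA k X).le) (hKd X) (hKloc X hX hc) h1

end Literature.MathematicalPhysics.StatisticalMechanics.GradientRG

end
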